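import Literature.MathematicalPhysics.KineticTheory.IdealGasEulerLocalTheory
import Literature.Analysis.FluidPDE.IsentropicEulerUniformLifespan
import Literature.Analysis.FluidPDE.CompressibleEulerLocalExistence
import HarnessLib

/-!
# Quantitative local existence for the ideal-gas compressible Euler system on `𝕋³`: the
# discharge of `idealGasEuler_localExistence_quant`

MathematicalPhysics/KineticTheory proof file (theorems only; no definitions, no named facts),
sibling of `IdealGasEulerLocalTheory.lean`, discharging the named fact
`Literature.MathematicalPhysics.KineticTheory.idealGasEuler_localExistence_quant` (Majda 1984,
Thm 2.1 with the life span and the high-norm bound of its proof, for the monatomic ideal gas on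
`𝕋³`: ONE interval of classical existence `[0, T_*)` and ONE set of state / `C¹` bounds `M` for all
smooth data `(ρ₀, θ₀, u₀)` with `ρ₀, θ₀ ≥ B⁻¹` and `‖Dⁿ lift ·‖ ≤ B`, `n ≤ 3`).

The proof is the printed one and is entirely in the tree:

* `Literature.Analysis.FluidPDE.CompressibleEulerLocalWellPosedness_holds`
  (`CompressibleEulerLocalExistence.lean`): local existence from smooth data and the `C¹`
  continuation principle for the complete Euler system of a monatomic fluid with the athermal law
  `p = ρϑζ(ρ)`, `e = 3ϑ/2` (Majda 1984, Thms 2.1–2.2), here with `ζ ≡ 1`;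
* `Literature.Analysis.FluidPDE.CompressibleEuler.exists_solution_upto_general`
  (`IsentropicEulerUniformLifespan.lean`): from that fact, existence up to a time `t₀(B, m)` with
  bounds `M(B, m)`, by the uniform `H³` energy inequality, Sobolev, the transport bounds read off
  the equations and the continuity principle (Majda 1984, proof of Thm 2.1 via (2.38); Dafermos
  2005, proof of Thm 5.1.1, (5.1.17));
* the identification of the `σ = 0` hard-sphere system with the ideal gas
  (`isHardSphereEulerSolution_zero_of_classical`: `hsPressure 0 ρ θ = ρθ`,
  `totalEnergyDensity ρ u θ = ρ(|u|²/2 + 3θ/2)`).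

## References

* A. Majda, *Compressible Fluid Flow and Systems of Conservation Laws in Several Space
  Variables*, Appl. Math. Sci. 53, Springer 1984, Ch. 2 §2.1, Thm 2.1 ("`T` depends on `‖u₀‖ₛ`
  and `G₁`"), Thm 2.2 with (2.38), Cor. 1–2; C.I.M.E. notes (LNM 1047, 1984), §§1–2.
  [`Majda1984`, `MajdaCIME1984`]
* C. M. Dafermos, *Hyperbolic Conservation Laws in Continuum Physics*, 2nd ed., Springer 2005,
  Ch. V, Thm 5.1.1 and its proof, (5.1.17). [`Dafermos2005`]
-/

noncomputable section

open Set

namespace Literature.MathematicalPhysics.KineticTheory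

open Literature.Analysis.FunctionSpaces
open Literature.Analysis.FluidPDE Literature.Analysis.FluidPDE.CompressibleEuler

/-- **The `σ = 0` hard-sphere Euler system is the ideal gas**: a classical solution of the
complete Euler system for `EulerEOS.monatomicExcess 1 f` (`p = ρϑ`, `e = 3ϑ/2`) is a classical
hard-sphere Euler solution at reduced diameter `σ = 0` (`hsPressure 0 ρ θ = ρθ Z(0) = ρθ`,
`totalEnergyDensity ρ u θ = ρ(|u|²/2 + 3θ/2)`), field by field. [folklore] -/
theorem isHardSphereEulerSolution_zero_of_classical {f : ℝ → ℝ} {T : ℝ} {ρ θ : ℝ → T3 → ℝ}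
    {u : ℝ → T3 → V3}
    (h : IsClassicalEulerSolution (EulerEOS.monatomicExcess (fun _ => 1) f) T ρ u θ) :
    IsHardSphereEulerSolution 0 T ρ u θ := by
  have hp : ∀ r s : ℝ, hsPressure 0 r s = (EulerEOS.monatomicExcess (fun _ => (1 : ℝ)) f).p r s := by
    intro r s
    simp [hsPressure, hsCompressibility, EulerEOS.monatomicExcess]
  have he : ∀ (r : ℝ) (v : V3) (s : ℝ), totalEnergyDensity r v s =
      r * (‖v‖ ^ 2 / 2 + (EulerEOS.monatomicExcess (fun _ => (1 : ℝ)) f).e r s) := by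
    intro r v s
    simp [totalEnergyDensity, EulerEOS.monatomicExcess]
  refine ⟨h.smooth_density, h.smooth_velocity, h.smooth_temperature, h.density_pos, h.temperature_pos,
    h.mass, fun t ht x => ?_, fun t ht x => ?_⟩
  · simp only [hp]
    exact h.momentum t ht x
  · simp only [he, hp]
    exact h.energy t ht x

/-- **`idealGasEuler_localExistence_quant` holds** (Majda 1984, Thm 2.1 with the life span
`T(‖u₀‖ₛ, G₁)` and the high-norm bound of its proof; Dafermos 2005, Thm 5.1.1): for every `B > 0`
the time `t₀(B, B⁻¹)` and the bound `M(B, B⁻¹)` of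
`CompressibleEuler.exists_solution_upto_general`, fed with the tree's theorem
`CompressibleEulerLocalWellPosedness_holds`, serve all smooth data with `ρ₀, θ₀ ≥ B⁻¹` and
`‖Dⁿ lift ρ₀‖, ‖Dⁿ lift θ₀‖, ‖Dⁿ lift u₀‖ ≤ B` (`n ≤ 3`); the ideal-gas solution is the `σ = 0`
hard-sphere solution (`isHardSphereEulerSolution_zero_of_classical`).
[cite: MajdaCIME1984, §1 Thm 2.1 with §2 Lemma 2.1, §2.1 Thm 2.2 (2.38)]
[cite: Majda1984, Ch. 2 §2.1 Thm 2.1, Thm 2.2] -/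
theorem idealGasEuler_localExistence_quant_holds : idealGasEuler_localExistence_quant := by
  intro B hB
  obtain ⟨t₀, ht₀, M, hM, hsol⟩ :=
    exists_solution_upto_general CompressibleEulerLocalWellPosedness_holds B B⁻¹ (inv_pos.2 hB)
  refine ⟨t₀, ht₀, M, hM, fun ρ₀ θ₀ u₀ hρ₀ hθ₀ hu₀ hflρ hflθ hbρ hbθ hbu => ?_⟩
  obtain ⟨ρ, ϑ, u, h, hρ0, hu0, hϑ0, hbds⟩ := hsol ρ₀ θ₀ u₀ hρ₀ hθ₀ hu₀ hflρ hflθ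
    fun n hn y => ⟨hbρ n hn y, hbu n hn y, hbθ n hn y⟩
  exact ⟨ρ, ϑ, u, isHardSphereEulerSolution_zero_of_classical h, hρ0, hu0, hϑ0, hbds⟩

end Literature.MathematicalPhysics.KineticTheory

end
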